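import Mathlib
import Literature.NumberTheory.Irrationality.LaiSprangZudilin2026.RecurrenceProofs
import Literature.NumberTheory.Irrationality.LaiSprangZudilin2026.PartialFractions
import HarnessLib

/-!
# Lai–Sprang–Zudilin 2026, Lemma 5.2 UNCONDITIONALLY: the recurrence-defined `ρ_n` is the binomial double sum,
`ρ_n ∈ ℤ_{>0}`, and `ρ_{n,3} = 768 ρ_n ∈ ℤ` (the first half of the expectation (5.2))

Topic `Literature/NumberTheory/Irrationality`, namespace `Literature.NumberTheory.Irrationality.LaiSprangZudilin2026`.
Source: L. Lai, J. Sprang, W. Zudilin, arXiv:2505.05005 v2 = IMRN 2026 (rnag180) [LaiSprangZudilin2026], §5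
(held text `paper:arxiv-2505.05005`, chunk p0008).

This short file only COMPOSES results already in the tree:

* `recurrence_holds` (`RecurrenceProofs.lean`, zi-lit g15): the double sum `lszRho` satisfies (eq:rec) — the
  creative-telescoping heart of Lemma 5.2;
* `rhoQ_eq_lszRho (h : recurrence)` (`SecondSolution.lean`) and `pfRho3_eq_lszRho (h : recurrence)`,
  `pfRho3_eq_rho3` (`PartialFractions.lean`): the bridges from the recurrence-defined `rhoQ = recSol 1 96`,
  `rho3 = 768·rhoQ` and from the printed partial-fraction coefficient `pfRho3` = (def_rho_3) to `lszRho`,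

so that the printed statement is available by name, without the hypothesis `(h : recurrence)`:

> **Lemma 5.2.** «The solution `(ρ_n)_{n≥0}` of the difference equation (eq:rec) with the initial conditions
> `ρ_0 = 1`, `ρ_1 = 96` is given by the binomial double sum
> `ρ_n = Σ_{0≤i≤k≤n} 2^{4(n−k)} C(2i,i)² C(2n−2i,n−i) C(2k−2i,k−i) C(2k,k)² C(2n−2k,n−k)`.
> Furthermore, for the coefficients `ρ_{n,3}` given in (def_rho_3) we have `ρ_{n,3} = 768ρ_n ∈ ℤ` for `n ∈ ℤ_{≥0}`.»
> [LaiSprangZudilin2026, Lemma 5.2, p0008]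

and, with it, the FIRST inclusion of the expectation

> «`ρ_{n,3} ∈ ℤ` and `d_n^5·ρ_{n,0} ∈ ℤ` for all `n ∈ ℤ_{>0}`» [LaiSprangZudilin2026, (5.2), p0008]

(«we demonstrate below that indeed `ρ_{n,3} ∈ ℤ` for `n ∈ ℤ_{>0}`», ibid.).  The SECOND inclusion of (5.2) is NOT
proved here (nor in print): the tree has `d_n^6 ρ_{n,0} ∈ ℤ` (`lemma51_holds`, Lemma 5.1) and
`Φ_n⁻¹ d_n^6 ρ_{n,0} ∈ ℤ` conditionally on Lemma 5.3 (`lemma54_of_lemma53`).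

## Contents (all PROVED; no named fact)

* `rhoQ_eq_lszRho'` — Lemma 5.2 (i): `rhoQ n = lszRho n`; `recSol_eq_lszRho` (same, `recSol 1 96`).
* `lszRho_pos`, `rhoQ_pos`, `exists_nat_rhoQ`, `exists_int_rhoQ` — `ρ_n` is a positive integer
  («its solution `{1, 96, 14944, …}` is integer-valued», §1).
* `rho3_eq_lszRho`, `pfRho3_eq_lszRho'` — Lemma 5.2 (ii): `ρ_{n,3} = 768 ρ_n` for the recurrence-defined `rho3`
  and for the printed (def_rho_3) `pfRho3`.
* `exists_int_rho3`, `exists_int_pfRho3`, `rho3_pos` — `ρ_{n,3} ∈ ℤ_{>0}`: the first half of (5.2).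

HONEST FRAMING (cell zeta5-irr): arithmetic of the `ζ₂(5)`-coefficient only; nothing here about `ζ(5)`, and the
denominator conjecture's second half stays open.
-/

namespace Literature.NumberTheory.Irrationality.LaiSprangZudilin2026

open Finset
open Literature.Combinatorics.Enumerative.TwoAdicZetaFiveAperyLikeLucas

/-! ## Lemma 5.2 (i): the recurrence-defined solution is the double sum -/

/-- **Lemma 5.2 (i)** (unconditional): the solution of (eq:rec) with `ρ_0 = 1`, `ρ_1 = 96` — the tree's
`rhoQ = recSol 1 96` — equals the binomial double sum `lszRho n` for every `n`.
[cite: LaiSprangZudilin2026, Lemma 5.2] -/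
theorem rhoQ_eq_lszRho' (n : ℕ) : rhoQ n = lszRho n :=
  rhoQ_eq_lszRho recurrence_holds n

/-- Lemma 5.2 (i) spelled on `recSol 1 96`. [cite: LaiSprangZudilin2026, Lemma 5.2] -/
theorem recSol_eq_lszRho (n : ℕ) : recSol 1 96 n = lszRho n :=
  rhoQ_eq_lszRho' n

/-- The double sum is positive: its `(i,k) = (0,0)` term is `2^{4n} C(2n,n)² > 0` and all terms are `≥ 0`.
[cite: LaiSprangZudilin2026, Lemma 5.2 (display)] -/
theorem lszRho_pos (n : ℕ) : 0 < lszRho n := by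
  unfold lszRho
  have h0 : 0 ∈ range (n + 1) := by simp
  refine lt_of_lt_of_le ?_ (single_le_sum (s := range (n + 1))
    (f := fun k => ∑ i ∈ range (k + 1), 2 ^ (4 * (n - k)) * (2 * i).choose i ^ 2 * (2 * n - 2 * i).choose (n - i) *
      (2 * k - 2 * i).choose (k - i) * (2 * k).choose k ^ 2 * (2 * n - 2 * k).choose (n - k))
    (fun _ _ => Nat.zero_le _) h0)
  simp only [zero_add, range_one, sum_singleton, mul_zero, Nat.sub_zero, Nat.choose_zero_right, one_pow, mul_one]
  exact Nat.mul_pos (Nat.mul_pos (by positivity) (Nat.choose_pos (by omega))) (Nat.choose_pos (by omega))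

/-- `ρ_n > 0` for the recurrence-defined solution. [cite: LaiSprangZudilin2026, Lemma 5.2] -/
theorem rhoQ_pos (n : ℕ) : 0 < rhoQ n := by
  rw [rhoQ_eq_lszRho']
  exact_mod_cast lszRho_pos n

/-- `ρ_n ∈ ℤ_{≥0}`: «its solution `{1, 96, 14944, …}` is integer-valued» — for the tree's `ℚ`-valued `rhoQ`.
[cite: LaiSprangZudilin2026, §1 (after (eq:rec)); Lemma 5.2] -/
theorem exists_nat_rhoQ (n : ℕ) : ∃ m : ℕ, rhoQ n = m :=
  ⟨lszRho n, rhoQ_eq_lszRho' n⟩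

/-- `ρ_n ∈ ℤ` (integer form). [cite: LaiSprangZudilin2026, §1 (after (eq:rec)); Lemma 5.2] -/
theorem exists_int_rhoQ (n : ℕ) : ∃ z : ℤ, rhoQ n = z :=
  ⟨lszRho n, by rw [rhoQ_eq_lszRho']; norm_cast⟩

/-! ## Lemma 5.2 (ii): `ρ_{n,3} = 768 ρ_n ∈ ℤ` -/

/-- **Lemma 5.2 (ii)** for the recurrence-defined `rho3 = 768·recSol 1 96` (the cell's den-con vocabulary):
`ρ_{n,3} = 768 ρ_n`. [cite: LaiSprangZudilin2026, Lemma 5.2] -/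
theorem rho3_eq_lszRho (n : ℕ) : rho3 n = 768 * (lszRho n : ℚ) := by
  rw [rho3, rhoQ_eq_lszRho']

/-- **Lemma 5.2 (ii)** AS PRINTED, unconditional: for the coefficient `ρ_{n,3}` given in (def_rho_3)
(`pfRho3 n = 384 Σ_k r_{n,3,k}`), `ρ_{n,3} = 768 ρ_n`. [cite: LaiSprangZudilin2026, Lemma 5.2] -/
theorem pfRho3_eq_lszRho' (n : ℕ) : pfRho3 n = 768 * (lszRho n : ℚ) :=
  pfRho3_eq_lszRho recurrence_holds n

/-- **`ρ_{n,3} ∈ ℤ`** for the recurrence-defined `rho3` — the first inclusion of the expectation (5.2)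
(«we demonstrate below that indeed `ρ_{n,3} ∈ ℤ`»), here for every `n ≥ 0`.
[cite: LaiSprangZudilin2026, Lemma 5.2 and (5.2)] -/
theorem exists_int_rho3 (n : ℕ) : ∃ z : ℤ, rho3 n = z :=
  ⟨768 * lszRho n, by rw [rho3_eq_lszRho]; push_cast; ring⟩

/-- **`ρ_{n,3} ∈ ℤ`** for the printed (def_rho_3) coefficient. [cite: LaiSprangZudilin2026, Lemma 5.2 and (5.2)] -/
theorem exists_int_pfRho3 (n : ℕ) : ∃ z : ℤ, pfRho3 n = z := by
  rw [pfRho3_eq_rho3]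
  exact exists_int_rho3 n

/-- `ρ_{n,3} > 0`. [cite: LaiSprangZudilin2026, Lemma 5.2] -/
theorem rho3_pos (n : ℕ) : 0 < rho3 n := by
  rw [rho3]
  exact mul_pos (by norm_num) (rhoQ_pos n)

/-- `ρ_{n,3} ∈ 768ℤ`: the integer `ρ_{n,3}/768 = ρ_n` is the double sum (divisibility form of Lemma 5.2 (ii)).
[cite: LaiSprangZudilin2026, Lemma 5.2] -/
theorem rho3_div_eq_lszRho (n : ℕ) : rho3 n / 768 = lszRho n := by
  rw [rho3_eq_lszRho]
  ring

end Literature.NumberTheory.Irrationality.LaiSprangZudilin2026
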